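import Literature.NumberTheory.EllipticCurves.KellerYin2024.CharacterModulePrufer
import Literature.NumberTheory.GaloisRepresentations.FramedRepTwist
import Literature.NumberTheory.GaloisRepresentations.CohomologicalDimension
import Literature.GroupTheory.Abelian.PruferGroupEndomorphismRing
import HarnessLib

/-!
# `(F/𝓞)(θ ⊗ χ)` versus `(F/𝓞)(θ)`: the character module of a twisted rank-one character is the
# character module of `θ` with the Galois action multiplied by `χ` (Greenberg's «`A_s = A` as groups»
# for Keller–Yin's `A = (F/𝓞)(θ)`, `F = ℚ_p`; all PROVED, no named fact)

Keller–Yin 2024 §1.1 attach to a character `θ : G_K → 𝓞^×` the cofree rank-one module `(F/𝓞)(θ)`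
(the tree's `KellerYin2024.charModule S θ = GreenbergSelmer.Cofree θ F`); for `S = ∅` (`F = ℚ_p`,
`𝓞 ≅ ℤ_p`) the tree identifies it with `ℚ_p/ℤ_p` carrying the scalar action of the `ℤ_pˣ`-valued character
`unitChar θ` (`charModuleEquiv`, `charModuleEquiv_galois_smul`). Greenberg, LNM 1716 §4 p. 105–107: twisting a
discrete module by a character does not change the group, only the action («as `G_{F_∞}`-modules `A_s = A`»).
This file records that dictionary for the TWIST `θ ⊗ χ` (`FramedRep.twist θ χ`, `χ : Γ_K →ₜ* 𝓞ˣ`): along the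
composite identification `Φ := charModuleEquiv (θ ⊗ χ) ≫ (charModuleEquiv θ)⁻¹ : (F/𝓞)(θ ⊗ χ) ≃+ (F/𝓞)(θ)` one has
`Φ(σ • t) = χ(σ) · σ • Φ(t)`, the scalar `χ(σ) ∈ 𝓞ˣ ≅ ℤ_pˣ` read on the `p^k`-torsion element `σ • Φ t` through
`ℤ_p → ℤ/p^k` — exactly the hypothesis `hφ` of the tree's character-twist transport
`CharTwist.exists_dualData₂_charTwist` (`Rubin1991/TwoVariableDualDataCharacterTwist.lean`) with
`c = e_𝓞⁻¹ ∘ χ`, `M = (F/𝓞)(θ)`, `M′ = (F/𝓞)(θ ⊗ χ)`.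

## Contents

* §1 `padicInt_smul_eq_val_toZModPow_nsmul` — on a `p^k`-torsion element of a `ℤ_p`-module, `z • x = (z mod p^k) • x`.
* §2 `unitChar_twist` (`unitChar (θ ⊗ χ) = (e_𝓞⁻¹ ∘ χ) · unitChar θ`), `isPrimaryTorsion_charModule`,
  **`charModuleEquiv_twist_galois_smul`** (the law `Φ(σ • t) = val_k(e_𝓞⁻¹ χ σ) • σ • Φ t`), and
  `unitsMap_symm_eq_one_of_apply_eq_one` (`χ σ = 1 ⇒` the twisting unit is `1`, for the `pairKer` clause),
  `twist_apply_entry`, `galois_smul_charModuleEquiv_symm`.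

Cell `bsd-print-cf2`, width seat `bsd-line-cf2-p1-w5` g2, brick B1 completion (residue (1) of g0: «`charModule (θ ⊗ ε) ≃
PairUnitTwist (charModule θ)` Γ_K-equivariantly», delivered model-free as the `hφ` law), crux
`PrintCf2.SplitBadTwoRankOneOfFacts` (stmt-BirchSwinnertonDyer-20368), road α. No named fact, no `sorry`, no `instance`,
no notation, no new definition.

## References

* [KellerYin2024] T. Keller, M. Yin, arXiv:2402.12781v2, §1.1 (`A = (F/𝓞)(θ)`).
* [GreenbergLNM1716] R. Greenberg, LNM 1716 (1999), §4 pp. 105–107 (`A_s = A ⊗ κ^s`, «as `G_{F_∞}`-modules `A_s = A`»).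
* [Kaplansky1954] I. Kaplansky, *Infinite Abelian Groups*, §14 (scalars of `ℤ_p` on `p`-primary groups).
* [SerreGaloisCohomology1997] J.-P. Serre, *Galois Cohomology*, I §5.3 (twisting).
-/

noncomputable section

open Field Topology
open Literature.NumberTheory.GaloisRepresentations
open Literature.NumberTheory.IwasawaTheory
open Literature.GroupTheory.Abelian.PruferGroup

namespace Literature.NumberTheory.EllipticCurves.KellerYin2024

/-! ### §1. `ℤ_p`-scalars on `p^k`-torsion elements -/

section Scalars

variable {p : ℕ} [Fact p.Prime] {A : Type*} [AddCommGroup A] [Module ℤ_[p] A]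

/-- **On a `p^k`-torsion element of a `ℤ_p`-module, `z ∈ ℤ_p` acts as the natural number `z mod p^k`**
(`z − (z mod p^k) ∈ p^kℤ_p` kills the element). Kaplansky §14: a `p`-primary group is a `ℤ_p`-module through its
residues. [cite: Kaplansky1954, §14 (PDF p. 47)] -/
theorem padicInt_smul_eq_val_toZModPow_nsmul {k : ℕ} {x : A} (hx : p ^ k • x = 0) (z : ℤ_[p]) :
    z • x = (PadicInt.toZModPow k z).val • x := by
  haveI : NeZero (p ^ k) := ⟨pow_ne_zero _ (Fact.out : p.Prime).ne_zero⟩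
  have hmem : z - ((PadicInt.toZModPow k z).val : ℤ_[p]) ∈ RingHom.ker (PadicInt.toZModPow k) := by
    rw [RingHom.mem_ker, map_sub, map_natCast, ZMod.natCast_zmod_val, sub_self]
  rw [PadicInt.ker_toZModPow, Ideal.mem_span_singleton] at hmem
  obtain ⟨q, hq⟩ := hmem
  have hz : z = ((PadicInt.toZModPow k z).val : ℤ_[p]) + (p : ℤ_[p]) ^ k * q := by
    rw [← hq]; ring
  conv_lhs => rw [hz]
  rw [add_smul, Nat.cast_smul_eq_nsmul, mul_comm, mul_smul, ← Nat.cast_pow, Nat.cast_smul_eq_nsmul, hx,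
    smul_zero, add_zero]

end Scalars

/-! ### §2. The character module of a twist -/

section Twist

variable {K : Type} [Field K] {p : ℕ} [Fact p.Prime]
  (θ : FramedGaloisRep K (padicCoeffIntegers (∅ : Set (PadicAlgCl p))) 1)
  (χ : absoluteGaloisGroup K →ₜ* (padicCoeffIntegers (∅ : Set (PadicAlgCl p)))ˣ)

/-- The entry of the twist: `(θ ⊗ χ)(σ)₀₀ = χ(σ) · θ(σ)₀₀`. [cite: SerreGaloisCohomology1997, I §5.3] -/
theorem twist_apply_entry (σ : absoluteGaloisGroup K) :
    ((FramedRep.twist θ χ σ : GL (Fin 1) (padicCoeffIntegers (∅ : Set (PadicAlgCl p)))) :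
        Matrix (Fin 1) (Fin 1) (padicCoeffIntegers (∅ : Set (PadicAlgCl p)))) 0 0 =
      (χ σ : padicCoeffIntegers (∅ : Set (PadicAlgCl p))) *
        ((θ σ : GL (Fin 1) (padicCoeffIntegers (∅ : Set (PadicAlgCl p)))) :
          Matrix (Fin 1) (Fin 1) (padicCoeffIntegers (∅ : Set (PadicAlgCl p)))) 0 0 := by
  rw [FramedRep.coe_twist_apply, Matrix.smul_apply, smul_eq_mul]

/-- **The unit character of a twist: `unitChar (θ ⊗ χ) σ = e_𝓞⁻¹(χ σ) · unitChar θ σ`** (`e_𝓞 : ℤ_p ≅ 𝓞`).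
[cite: KellerYin2024, §1.1 (arXiv:2402.12781v2 TeX L441–449)] -/
theorem unitChar_twist (σ : absoluteGaloisGroup K) :
    unitChar (FramedRep.twist θ χ) σ =
      Units.map (padicIntEquivCoeffIntegersEmpty p).symm.toRingHom.toMonoidHom (χ σ) * unitChar θ σ := by
  apply Units.ext
  apply (padicIntEquivCoeffIntegersEmpty p).injective
  rw [padicIntEquiv_unitChar, twist_apply_entry, Units.val_mul, map_mul, padicIntEquiv_unitChar,
    Units.coe_map]
  congr 1
  exact ((padicIntEquivCoeffIntegersEmpty p).apply_symm_apply _).symm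

/-- If `χ σ = 1` the twisting unit `e_𝓞⁻¹(χ σ)` is `1` (the `pairKer` clause `hc` of the character-twist transport
for a character `χ` of the `ℤ_p²`-tower). [cite: GreenbergLNM1716, §4 p. 107] -/
theorem unitsMap_symm_eq_one_of_apply_eq_one {σ : absoluteGaloisGroup K} (h : χ σ = 1) :
    Units.map (padicIntEquivCoeffIntegersEmpty p).symm.toRingHom.toMonoidHom (χ σ) = 1 := by
  rw [h, map_one]

/-- **`(F/𝓞)(θ)` is `p`-primary** (`IsPrimaryTorsion`; the tree's `exists_pow_smul_cofree_eq_zero`).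
[cite: KellerYin2024, §1.1 (arXiv:2402.12781v2 TeX L441–449)] -/
theorem isPrimaryTorsion_charModule : IsPrimaryTorsion p (charModule (∅ : Set (PadicAlgCl p)) θ) :=
  fun a ↦ GreenbergSelmer.exists_pow_smul_cofree_eq_zero (∅ : Set (PadicAlgCl p)) θ a

/-- `σ • a` read in `ℚ_p/ℤ_p` along `charModuleEquiv θ` and pulled back: `σ • e_θ⁻¹ b = e_θ⁻¹ (unitChar θ σ • b)`.
[cite: KellerYin2024, §1.1 (arXiv:2402.12781v2 TeX L441–449)] -/
theorem galois_smul_charModuleEquiv_symm (σ : absoluteGaloisGroup K) (b : QpModZp p) :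
    σ • (charModuleEquiv θ).symm b = (charModuleEquiv θ).symm (((unitChar θ σ : ℤ_[p]ˣ) : ℤ_[p]) • b) := by
  apply (charModuleEquiv θ).injective
  rw [charModuleEquiv_galois_smul, AddEquiv.apply_symm_apply, AddEquiv.apply_symm_apply]

/-- **THE TWIST LAW `hφ` for `(F/𝓞)(θ ⊗ χ) ≃ (F/𝓞)(θ)`.** Along `Φ = e_θ⁻¹ ∘ e_{θ ⊗ χ}` (`e = charModuleEquiv`):
`Φ(σ • t) = (e_𝓞⁻¹(χ σ) mod p^k) • σ • Φ(t)` for every `t` killed by `p^k` — Greenberg's «`A_s = A` as groups, the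
action multiplied by the character», for Keller–Yin's character modules; this is VERBATIM the hypothesis `hφ` of
`CharTwist.exists_dualData₂_charTwist` with `c := e_𝓞⁻¹ ∘ χ`. [cite: GreenbergLNM1716, §4 p. 105–107]
[cite: KellerYin2024, §1.1 (arXiv:2402.12781v2 TeX L441–449)] -/
theorem charModuleEquiv_twist_galois_smul (σ : absoluteGaloisGroup K) (k : ℕ)
    (t : charModule (∅ : Set (PadicAlgCl p)) (FramedRep.twist θ χ)) (ht : p ^ k • t = 0) :
    ((charModuleEquiv (FramedRep.twist θ χ)).trans (charModuleEquiv θ).symm) (σ • t) =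
      (PadicInt.toZModPow k
          ((Units.map (padicIntEquivCoeffIntegersEmpty p).symm.toRingHom.toMonoidHom (χ σ) : ℤ_[p]ˣ) : ℤ_[p])).val •
        (σ • ((charModuleEquiv (FramedRep.twist θ χ)).trans (charModuleEquiv θ).symm) t) := by
  set u : ℤ_[p]ˣ := Units.map (padicIntEquivCoeffIntegersEmpty p).symm.toRingHom.toMonoidHom (χ σ) with hu
  set b : QpModZp p := charModuleEquiv (FramedRep.twist θ χ) t with hb
  have hbk : p ^ k • b = 0 := by rw [hb, ← map_nsmul, ht, map_zero]
  have hbk' : p ^ k • (((unitChar θ σ : ℤ_[p]ˣ) : ℤ_[p]) • b) = 0 := by rw [smul_comm, hbk, smul_zero]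
  rw [AddEquiv.trans_apply, AddEquiv.trans_apply, charModuleEquiv_galois_smul, unitChar_twist, ← hu, ← hb,
    galois_smul_charModuleEquiv_symm, ← map_nsmul, Units.val_mul, mul_smul,
    padicInt_smul_eq_val_toZModPow_nsmul hbk']

end Twist

end Literature.NumberTheory.EllipticCurves.KellerYin2024

end
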